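import Literature.Algebra.Homology.KunnethDirectSum
import Literature.Algebra.Homology.EulerPoincareFormula
import Mathlib.LinearAlgebra.Dimension.Constructions
import HarnessLib

/-!
# `finrank` of a finitely supported direct sum, and the dimension of `(C ⊗ D)ⁿ`

Layer `Literature/Algebra/Homology` (pure linear algebra over Mathlib; proved theorems only, 0 definitions, 0 named
facts, no instances, no notation). FILE 1 of 2 of the multiplicativity of the Euler characteristic (FILE 2 =
`EulerCharacteristicTensor`).

* **`finrank_directSum_eq_sum_of_subsingleton`** ∕ **`finrank_directSum_eq_sum_of_finrank_eq_zero`**: for a family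
  `M : ι → Type` of finite-dimensional vector spaces over a division ring indexed by an ARBITRARY type `ι` and a `Finset s`
  off which the `M i` are trivial, `finrank K (⨁ i, M i) = Σ_{i ∈ s} finrank K (M i)` — through the evaluation
  equivalence `(⨁ i, M i) ≃ₗ[K] Π (i : s), M i` (`nonempty_directSum_linearEquiv_pi`, `DirectSum.mk` ∕ `DirectSum.ext`)
  and `Module.finrank_pi_fintype`; `moduleFinite_directSum_of_subsingleton`. DEDUP (searched): Mathlib (pin v4.32) has
  `Module.finrank_directSum` ONLY for `[Fintype ι]` (`LinearAlgebra/Dimension/Constructions`), `rank_directSum` (a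
  cardinal sum, any `ι`) and `Module.finrank_pi_fintype`; the tree uses the `Fintype` form only — the finite-support form
  is new;
* **`finrank_tensorObj_X`**: for bounded cochain complexes `C`, `D` of finite-dimensional vector spaces over a field
  (`Cⁱ = 0` off `Finset.Icc a₁ b₁`, `Dʲ = 0` off `Finset.Icc a₂ b₂`),
  `finrank k ((C ⊗ D)ⁿ) = Σ_{(i,j) ∈ Icc a₁ b₁ ×ˢ Icc a₂ b₂, i+j=n} finrank k Cⁱ · finrank k Dʲ`, through the tree's
  `Literature.Algebra.Homology.tensorObjXIsoDirectSum` (`(C ⊗ D)ⁿ ≅ ⨁_{i+j=n} Cⁱ ⊗ Dʲ`, cited not restated) and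
  `Module.finrank_tensorProduct`; with `moduleFinite_tensorObj_X`, `finrank_tensorObj_X_eq_zero` (off `Icc (a₁+a₂) (b₁+b₂)`)
  and `finrankSupport_tensorObj_subset`.

Library only (cell `pub-hodge-ring2`, count-neutral); proves nothing about any crux, route or conjecture.

## References

* C. A. Weibel, *An introduction to homological algebra* (1994), 2.7.1 (the total tensor product complex). [Weibel1994]
* S. Lang, *Algebra* (2002), Ch. XVI §2 (dimension of a tensor product), Ch. XX §3. [Lang2002]
-/

open CategoryTheory CategoryTheory.Limits
open scoped DirectSum TensorProduct

universe v u w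

namespace Literature.Algebra.Homology.TensorObjFinrank

/-! ### `finrank` of a direct sum with finite support -/

section DirectSum

variable {K : Type u} [DivisionRing K] {ι : Type w} [DecidableEq ι] (M : ι → Type v)
  [∀ i, AddCommGroup (M i)] [∀ i, Module K (M i)]

/-- **Evaluation on a finite set carrying the support is an equivalence**: if the `M i` are trivial off the `Finset s`,
`(⨁ i, M i) ≃ₗ[K] Π (i : s), M i`. [cite: Lang2002, XX §3] -/
theorem nonempty_directSum_linearEquiv_pi (s : Finset ι) (hs : ∀ i, i ∉ s → Subsingleton (M i)) :
    Nonempty ((⨁ i, M i) ≃ₗ[K] (∀ i : s, M i)) := by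
  let f : (⨁ i, M i) →ₗ[K] (∀ i : s, M i) := LinearMap.pi fun i => DirectSum.component K ι M i.1
  refine ⟨LinearEquiv.ofBijective f ⟨?_, ?_⟩⟩
  · intro x y hxy
    refine DirectSum.ext (β := M) fun i => ?_
    by_cases hi : i ∈ s
    · exact congrFun hxy ⟨i, hi⟩
    · haveI := hs i hi
      exact Subsingleton.elim _ _
  · intro y
    refine ⟨DirectSum.mk M s fun i => y ⟨i.1, i.2⟩, funext fun i => ?_⟩
    change (DirectSum.mk M s fun i => y ⟨i.1, i.2⟩) i.1 = y i
    rw [DirectSum.mk_apply_of_mem i.2]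

/-- A direct sum of finite-dimensional spaces that are trivial off a finite set is finite-dimensional.
[cite: Lang2002, XX §3] -/
theorem moduleFinite_directSum_of_subsingleton [∀ i, Module.Finite K (M i)] (s : Finset ι)
    (hs : ∀ i, i ∉ s → Subsingleton (M i)) : Module.Finite K (⨁ i, M i) :=
  Module.Finite.equiv (nonempty_directSum_linearEquiv_pi M s hs).some.symm

/-- **`finrank K (⨁ i, M i) = Σ_{i ∈ s} finrank K (M i)`** for an arbitrary index type, when the finite-dimensional
`M i` are trivial off the `Finset s` (Mathlib's `Module.finrank_directSum` is the `Fintype ι` case). [cite: Lang2002, XX §3] -/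
theorem finrank_directSum_eq_sum_of_subsingleton [∀ i, Module.Finite K (M i)] (s : Finset ι)
    (hs : ∀ i, i ∉ s → Subsingleton (M i)) :
    Module.finrank K (⨁ i, M i) = ∑ i ∈ s, Module.finrank K (M i) := by
  rw [LinearEquiv.finrank_eq (nonempty_directSum_linearEquiv_pi M s hs).some, Module.finrank_pi_fintype,
    Finset.sum_coe_sort s (fun i => Module.finrank K (M i))]

/-- The same with the hypothesis `finrank K (M i) = 0` off `s`. [cite: Lang2002, XX §3] -/
theorem finrank_directSum_eq_sum_of_finrank_eq_zero [∀ i, Module.Finite K (M i)] (s : Finset ι)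
    (hs : ∀ i, i ∉ s → Module.finrank K (M i) = 0) :
    Module.finrank K (⨁ i, M i) = ∑ i ∈ s, Module.finrank K (M i) :=
  finrank_directSum_eq_sum_of_subsingleton M s fun i hi => Module.finrank_zero_iff.1 (hs i hi)

end DirectSum

/-! ### The dimension of `(C ⊗ D)ⁿ` -/

section Tensor

variable {k : Type u} [Field k] (C D : CochainComplex (ModuleCat.{u} k) ℤ) (a₁ b₁ a₂ b₂ : ℤ)
  (hC : ∀ i, i ∉ Finset.Icc a₁ b₁ → IsZero (C.X i)) (hD : ∀ j, j ∉ Finset.Icc a₂ b₂ → IsZero (D.X j))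

include hC hD in
/-- Off the box `Icc a₁ b₁ ×ˢ Icc a₂ b₂` the summand `Cⁱ ⊗ Dʲ` is trivial. [cite: Weibel1994, 2.7.1] -/
theorem subsingleton_tensorSummand (n : ℤ) (p : {p : ℤ × ℤ // p.1 + p.2 = n})
    (hp : p ∉ (Finset.Icc a₁ b₁ ×ˢ Finset.Icc a₂ b₂).subtype fun p : ℤ × ℤ => p.1 + p.2 = n) :
    Subsingleton (TensorSummand C D n p) := by
  rw [Finset.mem_subtype, Finset.mem_product, not_and_or] at hp
  rcases hp with h | h
  · haveI := ModuleCat.subsingleton_of_isZero (hC _ h)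
    exact inferInstance
  · haveI := ModuleCat.subsingleton_of_isZero (hD _ h)
    exact inferInstance

include hC hD in
/-- `(C ⊗ D)ⁿ` is finite-dimensional for bounded complexes of finite-dimensional spaces. [cite: Weibel1994, 2.7.1] -/
theorem moduleFinite_tensorObj_X [∀ i, Module.Finite k (C.X i)] [∀ j, Module.Finite k (D.X j)] (n : ℤ) :
    Module.Finite k ((HomologicalComplex.tensorObj C D).X n) := by
  haveI : Module.Finite k (TensorDirectSum C D n) :=
    moduleFinite_directSum_of_subsingleton (TensorSummand C D n) _ (subsingleton_tensorSummand C D a₁ b₁ a₂ b₂ hC hD n)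
  exact Module.Finite.equiv (tensorObjXIsoDirectSum C D n).toLinearEquiv.symm

include hC hD in
/-- **`dim (C ⊗ D)ⁿ = Σ_{(i,j) ∈ Icc a₁ b₁ ×ˢ Icc a₂ b₂, i+j=n} dim Cⁱ · dim Dʲ`** for bounded cochain complexes of
finite-dimensional vector spaces. [cite: Weibel1994, 2.7.1] [cite: Lang2002, XVI §2] -/
theorem finrank_tensorObj_X [∀ i, Module.Finite k (C.X i)] [∀ j, Module.Finite k (D.X j)] (n : ℤ) :
    Module.finrank k ((HomologicalComplex.tensorObj C D).X n) =
      ∑ p ∈ (Finset.Icc a₁ b₁ ×ˢ Finset.Icc a₂ b₂).filter (fun p : ℤ × ℤ => p.1 + p.2 = n),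
        Module.finrank k (C.X p.1) * Module.finrank k (D.X p.2) := by
  rw [LinearEquiv.finrank_eq (tensorObjXIsoDirectSum C D n).toLinearEquiv]
  change Module.finrank k (TensorDirectSum C D n) = _
  rw [finrank_directSum_eq_sum_of_subsingleton (TensorSummand C D n) _
      (subsingleton_tensorSummand C D a₁ b₁ a₂ b₂ hC hD n),
    ← Finset.sum_subtype_eq_sum_filter]
  refine Finset.sum_congr rfl fun p _ => ?_
  exact Module.finrank_tensorProduct

include hC hD in
/-- `(C ⊗ D)ⁿ = 0`-dimensional off `Icc (a₁ + a₂) (b₁ + b₂)`. [cite: Weibel1994, 2.7.1] -/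
theorem finrank_tensorObj_X_eq_zero [∀ i, Module.Finite k (C.X i)] [∀ j, Module.Finite k (D.X j)] (n : ℤ)
    (hn : n ∉ Finset.Icc (a₁ + a₂) (b₁ + b₂)) :
    Module.finrank k ((HomologicalComplex.tensorObj C D).X n) = 0 := by
  rw [finrank_tensorObj_X C D a₁ b₁ a₂ b₂ hC hD n]
  refine Finset.sum_eq_zero fun p hp => ?_
  exfalso
  simp only [Finset.mem_filter, Finset.mem_product, Finset.mem_Icc] at hp hn
  omega

include hC hD in
/-- The rank support of `C ⊗ D` lies in `Icc (a₁ + a₂) (b₁ + b₂)`. [cite: Weibel1994, 2.7.1] -/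
theorem finrankSupport_tensorObj_subset [∀ i, Module.Finite k (C.X i)] [∀ j, Module.Finite k (D.X j)] :
    GradedObject.finrankSupport (HomologicalComplex.tensorObj C D).X ⊆ (Finset.Icc (a₁ + a₂) (b₁ + b₂) : Finset ℤ) := by
  intro n hn
  by_contra hn'
  exact hn (finrank_tensorObj_X_eq_zero C D a₁ b₁ a₂ b₂ hC hD n hn')

end Tensor

end Literature.Algebra.Homology.TensorObjFinrank
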